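import Literature.IUT.HodgeArakelov.AbsTopInterfaces
import Literature.AnabelianGeometry.AbsoluteAnabelian.MLFGaloisModelPairs
import HarnessLib

/-!
# Bridge B9 (a): [IUTchII] Ex 1.8's `(G ↷ O^⊳(G))`, `(Π ↷ M_TM(Π))` as [AbsTopIII] Def 3.1 pairs

Mochizuki, *Inter-universal Teichmüller Theory II*, kurims manuscript (Dec 2020), Example 1.8 (ii) pp.36–37
[cite: Mochizuki2012, II Ex 1.8 (ii) p.36]; Mochizuki, *Topics in Absolute Anabelian Geometry III*, Def 3.1 (i)(ii)
pp.66–67 (the notion of an MLF-Galois `TM`-pair). (D-0012 claim key, status disputed; BRIDGE between two landed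
typings — nothing of the series is asserted.)

MERGE-MAP (plan/L6/MERGE-MAP.md) §8 B9 (a). [IUTchII] Ex 1.8 (ii) quotes "the resulting MLF-Galois `TM`-pair"
`(Π ↷ M_TM(Π))` of [AbsTopIII] Def 3.1 (vi) and `(G ↷ O^⊳(G))` of [AbsTopIII] Prop 5.8 (i). Two landed typings:
* abc-iut-L6-t1's INTERFACE `Literature.IUT.HodgeArakelov.AbsTopMonoids S` (`AbsTopInterfaces.lean` p407495):
  per object `G` of the groupoid `IsoClass S.Gk` a commutative monoid `Otri G` with an action
  `actOtri G : G.G →* MulAut (Otri G)`, functorially (`mapOtri`, `mapOtri_equivariant`); likewise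
  `MTM`/`actMTM`/`mapMTM` over `IsoClass S.PiX`;
* abc-iut-L4-t2's [AbsTopIII] Def 3.1 typing `Literature.AnabelianGeometry.AbsoluteAnabelian.GaloisMonoidPair`
  (`MLFGaloisPairs.lean`): a topological group `Pi`, a commutative monoid `M`, a `MulDistribMulAction Pi M`
  with OPEN STABILISERS, isomorphisms `GaloisMonoidPair.Iso` (`isoPi`, `isoM`, `smul_comm`), and the predicate
  `IsMLFGaloisMonoidPair T` ("isomorphic to the model `T`-pair of some model data").
The dictionary (abc-iut-L6-t21's concordance 2026-08-25T20:13:37Z, (a)): same content, the action packaged as a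
hom to `MulAut` versus a `MulDistribMulAction` — adapter `MulDistribMulAction.compHom`. What L6-t1's interface
does NOT record is the topology side of Def 3.1 (i) ("ind-topological monoid", here: open stabilisers): it is
carried below as the hypothesis structure `AbsTopMonoids.ContinuityLaws` (TODO-merge: supplied by the
instantiation of `AbsTopMonoids` from [AbsTopIII]'s model data, abc-iut-L4-t2 side — cf. `MLFGaloisModelPairs`).
With it: `toPair`/`toPairMTM : GaloisMonoidPair`, the induced `GaloisMonoidPair.Iso` of an isomorphism of
`IsoClass` (functoriality transported), and the merged reading `IsTMPair` of Ex 1.8 (ii)'s words "MLF-Galois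
`TM`-pair", PROVED invariant under isomorphisms of `G`.
-/

namespace Literature.IUT.HodgeArakelov

open CategoryTheory
open Literature.AnabelianGeometry.AbsoluteAnabelian

universe u

namespace AbsTopMonoids

variable {S : ThetaSetting.{u}} (A : AbsTopMonoids S)

/-! ### The actions as `MulDistribMulAction`s -/

/-- **IUTchII:Ex1.8(ii)** (kurims p.36) The action `G ↷ O^⊳(G)` of L6-t1's interface (a hom `G →* MulAut (O^⊳(G))`) as a
`MulDistribMulAction` — [AbsTopIII] Def 3.1 (i)'s packaging ("`Π` acts continuously on `M`"), via
`MulDistribMulAction.compHom`. A `def` (reducible), installed locally where needed, not a global instance.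
[claim: Mochizuki2012, status: disputed] -/
@[reducible] def otriAction (G : IsoClass S.Gk) : MulDistribMulAction G.G (A.Otri G) :=
  MulDistribMulAction.compHom (A.Otri G) (A.actOtri G)

/-- **IUTchII:Ex1.8(ii)** (kurims p.36) The action `Π ↷ M_TM(Π)` of L6-t1's interface as a `MulDistribMulAction`.
[claim: Mochizuki2012, status: disputed] -/
@[reducible] def mtmAction (P : IsoClass S.PiX) : MulDistribMulAction P.G (A.MTM P) :=
  MulDistribMulAction.compHom (A.MTM P) (A.actMTM P)

/-- **IUTchII:Ex1.8(ii)** (kurims p.36) Under `otriAction`, `g • m = actOtri G g m`. [claim: Mochizuki2012, status: disputed] -/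
theorem otriAction_smul (G : IsoClass S.Gk) (g : G.G) (m : A.Otri G) :
    (letI := A.otriAction G; g • m) = A.actOtri G g m := rfl

/-- **IUTchII:Ex1.8(ii)** (kurims p.36) Under `mtmAction`, `x • m = actMTM P x m`. [claim: Mochizuki2012, status: disputed] -/
theorem mtmAction_smul (P : IsoClass S.PiX) (x : P.G) (m : A.MTM P) :
    (letI := A.mtmAction P; x • m) = A.actMTM P x m := rfl

/-! ### The topology side of Def 3.1 (i), not recorded by the interface -/

/-- **IUTchII:Ex1.8(ii)** (kurims p.36) **Continuity laws** for L6-t1's `AbsTopMonoids`: [AbsTopIII] Def 3.1 (i) p.66 asks the monoid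
to be an IND-TOPOLOGICAL monoid with a CONTINUOUS action, which for the discrete pieces means OPEN STABILISERS
(abc-iut-L4-t2's `GaloisMonoidPair.isOpen_stabilizer`); L6-t1's interface records the monoids "WITHOUT their
ind-topologies" (its module docstring). Hypothesis structure (MERGE-MAP B9 (a) gap): every stabiliser of
`G ↷ O^⊳(G)` and of `Π ↷ M_TM(Π)` is open. TODO-merge: discharged by the instantiation of `AbsTopMonoids` from
[AbsTopIII]'s model data (`ModelMLFGaloisData.isOpen_stabilizer_comp`, abc-iut-L4-t2). [claim: Mochizuki2012, status: disputed] -/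
structure ContinuityLaws (A : AbsTopMonoids S) : Prop where
  /-- stabilisers of `G ↷ O^⊳(G)` are open -/
  isOpen_stabilizer_otri : ∀ (G : IsoClass S.Gk) (m : A.Otri G), IsOpen {g : G.G | A.actOtri G g m = m}
  /-- stabilisers of `Π ↷ M_TM(Π)` are open -/
  isOpen_stabilizer_mtm : ∀ (P : IsoClass S.PiX) (m : A.MTM P), IsOpen {x : P.G | A.actMTM P x m = m}

/-! ### The pairs -/

/-- **IUTchII:Ex1.8(ii)** (kurims p.36) `(G ↷ O^⊳(G))` as an [AbsTopIII] Def 3.1 pair (abc-iut-L4-t2's `GaloisMonoidPair`): `Pi := G`,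
`M := O^⊳(G)`, action `otriAction`, open stabilisers from `ContinuityLaws`. [claim: Mochizuki2012, status: disputed] -/
def toPair (hA : A.ContinuityLaws) (G : IsoClass S.Gk) : GaloisMonoidPair.{u} :=
  letI := A.otriAction G
  { Pi := G.G
    M := A.Otri G
    isOpen_stabilizer := fun m => by
      have h := hA.isOpen_stabilizer_otri G m
      have hs : (MulAction.stabilizer G.G m : Set G.G) = {g : G.G | A.actOtri G g m = m} := by
        ext g; exact MulAction.mem_stabilizer_iff
      rw [hs]; exact h }

/-- **IUTchII:Ex1.8(ii)** (kurims p.36) `(Π ↷ M_TM(Π))` as an [AbsTopIII] Def 3.1 pair: `Pi := Π`, `M := M_TM(Π)`, action `mtmAction`.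
[claim: Mochizuki2012, status: disputed] -/
def toPairMTM (hA : A.ContinuityLaws) (P : IsoClass S.PiX) : GaloisMonoidPair.{u} :=
  letI := A.mtmAction P
  { Pi := P.G
    M := A.MTM P
    isOpen_stabilizer := fun m => by
      have h := hA.isOpen_stabilizer_mtm P m
      have hs : (MulAction.stabilizer P.G m : Set P.G) = {x : P.G | A.actMTM P x m = m} := by
        ext x; exact MulAction.mem_stabilizer_iff
      rw [hs]; exact h }

/-- **IUTchII:Ex1.8(ii)** (kurims p.36) The group of `toPair` IS `G`. [claim: Mochizuki2012, status: disputed] -/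
theorem toPair_Pi (hA : A.ContinuityLaws) (G : IsoClass S.Gk) : (A.toPair hA G).Pi = G.G := rfl

/-- **IUTchII:Ex1.8(ii)** (kurims p.36) The monoid of `toPair` IS `O^⊳(G)`. [claim: Mochizuki2012, status: disputed] -/
theorem toPair_M (hA : A.ContinuityLaws) (G : IsoClass S.Gk) : (A.toPair hA G).M = A.Otri G := rfl

/-- **IUTchII:Ex1.8(ii)** (kurims p.36) The action of `toPair` IS `actOtri`. [claim: Mochizuki2012, status: disputed] -/
theorem toPair_smul (hA : A.ContinuityLaws) (G : IsoClass S.Gk) (g : (A.toPair hA G).Pi)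
    (m : (A.toPair hA G).M) : g • m = A.actOtri G g m := rfl

/-- **IUTchII:Ex1.8(ii)** (kurims p.36) The group of `toPairMTM` IS `Π`. [claim: Mochizuki2012, status: disputed] -/
theorem toPairMTM_Pi (hA : A.ContinuityLaws) (P : IsoClass S.PiX) : (A.toPairMTM hA P).Pi = P.G := rfl

/-- **IUTchII:Ex1.8(ii)** (kurims p.36) The monoid of `toPairMTM` IS `M_TM(Π)`. [claim: Mochizuki2012, status: disputed] -/
theorem toPairMTM_M (hA : A.ContinuityLaws) (P : IsoClass S.PiX) : (A.toPairMTM hA P).M = A.MTM P := rfl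

/-- **IUTchII:Ex1.8(ii)** (kurims p.36) The action of `toPairMTM` IS `actMTM`. [claim: Mochizuki2012, status: disputed] -/
theorem toPairMTM_smul (hA : A.ContinuityLaws) (P : IsoClass S.PiX) (x : (A.toPairMTM hA P).Pi)
    (m : (A.toPairMTM hA P).M) : x • m = A.actMTM P x m := rfl

/-! ### Functoriality: isomorphisms of `IsoClass` give isomorphisms of pairs -/

/-- **IUTchII:Ex1.8(ii)** (kurims p.38) "the isomorphism `(G ↷ O^×(G)) ≅ (G* ↷ O^×(G*))` induced by an isomorphism of topological groups
`G ≅ G*`": L6-t1's `mapOtri f` with the `IsoClass` isomorphism `f` IS an isomorphism of [AbsTopIII] pairs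
(`GaloisMonoidPair.Iso`: compatible with the actions by `mapOtri_equivariant`). [claim: Mochizuki2012, status: disputed] -/
def mapPairIso (hA : A.ContinuityLaws) {G H : IsoClass S.Gk} (f : G ⟶ H) :
    GaloisMonoidPair.Iso (A.toPair hA G) (A.toPair hA H) where
  isoPi := IsoClass.homIso f
  isoM := A.mapOtri f
  smul_comm g m := A.mapOtri_equivariant f g m

/-- **IUTchII:Ex1.8(ii)** (kurims p.36) Likewise for `(Π ↷ M_TM(Π))`: `mapMTM f` with `f` is an isomorphism of pairs
(`mapMTM_equivariant`). [claim: Mochizuki2012, status: disputed] -/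
def mapPairIsoMTM (hA : A.ContinuityLaws) {P Q : IsoClass S.PiX} (f : P ⟶ Q) :
    GaloisMonoidPair.Iso (A.toPairMTM hA P) (A.toPairMTM hA Q) where
  isoPi := IsoClass.homIso f
  isoM := A.mapMTM f
  smul_comm x m := A.mapMTM_equivariant f x m

/-- **IUTchII:Ex1.8(ii)** (kurims p.36) On the identity of `IsoClass`, the induced pair isomorphism has identity components
(`mapOtri_id`). [claim: Mochizuki2012, status: disputed] -/
theorem mapPairIso_id_isoM (hA : A.ContinuityLaws) (G : IsoClass S.Gk) :
    (A.mapPairIso hA (𝟙 G)).isoM = MulEquiv.refl (A.Otri G) := A.mapOtri_id G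

/-- **IUTchII:Ex1.8(ii)** (kurims p.36) On composites, the induced pair isomorphisms compose (`mapOtri_comp`).
[claim: Mochizuki2012, status: disputed] -/
theorem mapPairIso_comp_isoM (hA : A.ContinuityLaws) {G H K : IsoClass S.Gk} (f : G ⟶ H) (g : H ⟶ K) :
    (A.mapPairIso hA (f ≫ g)).isoM = (A.mapPairIso hA f).isoM.trans (A.mapPairIso hA g).isoM :=
  A.mapOtri_comp f g

/-! ### Isomorphisms of pairs: inverse and composite (plain constructions on L4-t2's record) -/

/-- **IUTchII:Ex1.8(ii)** (kurims p.36) The inverse of an isomorphism of [AbsTopIII] pairs. [claim: Mochizuki2012, status: disputed] -/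
def pairIsoSymm {P Q : GaloisMonoidPair.{u}} (e : GaloisMonoidPair.Iso P Q) : GaloisMonoidPair.Iso Q P where
  isoPi := e.isoPi.symm
  isoM := e.isoM.symm
  smul_comm g x := by
    apply e.isoM.injective
    rw [e.smul_comm, MulEquiv.apply_symm_apply, MulEquiv.apply_symm_apply]
    congr 1
    exact (e.isoPi.apply_symm_apply g).symm

/-- **IUTchII:Ex1.8(ii)** (kurims p.36) The composite of isomorphisms of [AbsTopIII] pairs. [claim: Mochizuki2012, status: disputed] -/
def pairIsoTrans {P Q R : GaloisMonoidPair.{u}} (e : GaloisMonoidPair.Iso P Q) (f : GaloisMonoidPair.Iso Q R) :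
    GaloisMonoidPair.Iso P R where
  isoPi := e.isoPi.trans f.isoPi
  isoM := e.isoM.trans f.isoM
  smul_comm g x := by
    change f.isoM (e.isoM (g • x)) = (f.isoPi (e.isoPi g)) • f.isoM (e.isoM x)
    rw [e.smul_comm, f.smul_comm]

/-- **IUTchII:Ex1.8(ii)** (kurims p.36) abc-iut-L4-t2's predicate "is an MLF-Galois `T`-pair" is invariant under isomorphisms of pairs
(it is defined as "isomorphic to a model pair"). [claim: Mochizuki2012, status: disputed] -/
theorem isMLFGaloisMonoidPair_of_iso {T : PairType} {P Q : GaloisMonoidPair.{u}}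
    (e : GaloisMonoidPair.Iso P Q) (hP : IsMLFGaloisMonoidPair T P) : IsMLFGaloisMonoidPair T Q := by
  obtain ⟨C, D, R, hR, ⟨i⟩⟩ := hP.exists_model
  exact ⟨⟨C, D, R, hR, ⟨pairIsoTrans i e⟩⟩⟩

/-- **IUTchII:Ex1.8(ii)** (kurims p.36) … hence an `Iff` along any isomorphism of pairs. [claim: Mochizuki2012, status: disputed] -/
theorem isMLFGaloisMonoidPair_iff_of_iso {T : PairType} {P Q : GaloisMonoidPair.{u}}
    (e : GaloisMonoidPair.Iso P Q) : IsMLFGaloisMonoidPair T P ↔ IsMLFGaloisMonoidPair T Q :=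
  ⟨isMLFGaloisMonoidPair_of_iso e, isMLFGaloisMonoidPair_of_iso (pairIsoSymm e)⟩

/-! ### The merged reading of "MLF-Galois TM-pair" in Ex 1.8 (ii) -/

/-- **IUTchII:Ex1.8(ii)** (kurims p.36) MERGED READING of "the resulting MLF-Galois `TM`-pair" `(G ↷ O^⊳(G))`: L6-t1's interface
datum at `G` IS an MLF-Galois `TM`-pair in abc-iut-L4-t2's sense ([AbsTopIII] Def 3.1 (ii)). A `Prop` about the
interface (TRUE for the intended instantiation by [AbsTopIII] Prop 5.8 (i); not asserted here).
[claim: Mochizuki2012, status: disputed] -/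
def IsTMPair (hA : A.ContinuityLaws) (G : IsoClass S.Gk) : Prop :=
  IsMLFGaloisMonoidPair .TM (A.toPair hA G)

/-- **IUTchII:Ex1.8(ii)** (kurims p.36) MERGED READING for `(Π ↷ M_TM(Π))` ([AbsTopIII] Def 3.1 (vi): "an MLF-Galois TM-pair … isomorphic
to the model"). [claim: Mochizuki2012, status: disputed] -/
def IsTMPairMTM (hA : A.ContinuityLaws) (P : IsoClass S.PiX) : Prop :=
  IsMLFGaloisMonoidPair .TM (A.toPairMTM hA P)

/-- **IUTchII:Ex1.8(ii)** (kurims p.38) The merged reading is INVARIANT under isomorphisms `G ≅ G*` of `IsoClass` (transport along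
`mapPairIso`) — as it must be for a "functorial group-theoretic algorithm". PROVED. [claim: Mochizuki2012, status: disputed] -/
theorem isTMPair_iff_of_hom (hA : A.ContinuityLaws) {G H : IsoClass S.Gk} (f : G ⟶ H) :
    A.IsTMPair hA G ↔ A.IsTMPair hA H :=
  isMLFGaloisMonoidPair_iff_of_iso (A.mapPairIso hA f)

/-- **IUTchII:Ex1.8(ii)** (kurims p.38) Hence the merged reading holds at every object of `IsoClass S.Gk` as soon as it holds at one
(the groupoid is connected: `IsoClass.nonempty_hom`). PROVED. [claim: Mochizuki2012, status: disputed] -/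
theorem isTMPair_forall_of_exists (hA : A.ContinuityLaws) (h : ∃ G, A.IsTMPair hA G) (H : IsoClass S.Gk) :
    A.IsTMPair hA H := by
  obtain ⟨G, hG⟩ := h
  obtain ⟨f⟩ := IsoClass.nonempty_hom G H
  exact (A.isTMPair_iff_of_hom hA f).1 hG

/-- **IUTchII:Ex1.8(ii)** (kurims p.36) Same invariance for `(Π ↷ M_TM(Π))` along isomorphisms of `IsoClass S.PiX`. PROVED.
[claim: Mochizuki2012, status: disputed] -/
theorem isTMPairMTM_iff_of_hom (hA : A.ContinuityLaws) {P Q : IsoClass S.PiX} (f : P ⟶ Q) :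
    A.IsTMPairMTM hA P ↔ A.IsTMPairMTM hA Q :=
  isMLFGaloisMonoidPair_iff_of_iso (A.mapPairIsoMTM hA f)

end AbsTopMonoids

end Literature.IUT.HodgeArakelov
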